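import Mathlib
import Literature.MathematicalPhysics.QuantumLattice.BallSpecification
import Literature.MathematicalPhysics.QuantumLattice.FieldConfigStandardBorel
import Literature.MathematicalPhysics.QuantumLattice.BallSpecificationProperKernels
import HarnessLib

/-!
# DLR ball kernels are versions of the regular conditional probability

Topic `MathematicalPhysics/QuantumLattice` (ball specifications for laws of random distributions, file
`BallSpecification`): THEOREM-ONLY file closing the bridge announced in the module docstring of
`BallSpecification.lean` ("`IsGibbsFor γ μ univ ⇒ (η ↦ γ c r η A)` is a version of
`μ[A | extEvents (closedBall c r)ᶜ]`, the `isGibbsMeasure_iff_condExp` analogue"), in kernel form now that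
`FieldConfig E = 𝓢'(E)` is known to be standard Borel for finite-dimensional `E`
(`FieldConfigStandardBorel.lean`, `standardBorelSpace_fieldConfig`; the first theorem is stated over the
instance hypothesis `[StandardBorelSpace (FieldConfig E)]`):

* `IsGibbsFor.apply_ae_eq_condExpKernel`: if `ν` satisfies the DLR equations for exterior-measurable ball
  kernels `γ` on the balls inside `U` (Georgii's Def. 1.23 (ii) + DLR), then for every such ball and every
  Borel event `A`, `η ↦ γ c r η A` agrees `ν`-a.e. with the regular conditional probability
  `condExpKernel ν (extEvents (closedBall c r)ᶜ) · A` (Georgii 2011, Prop. 7.22/7.25: a measure is Gibbs for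
  a specification iff the kernels are versions of its conditional probabilities given the exterior
  σ-algebras; Röckner 1986 §1 for the ball-indexed Euclidean-field setting);
* `IsGibbsFor.exists_germ_version`: if moreover the kernels are MARKOV across spheres (interior events are
  germ-measurable in the datum, Def. (iii) of `IsBallSpecification`), then every interior event has a
  germ-measurable version of its conditional probability given the exterior events — the a.e. one-sided
  germ-Markov property of `ν` on the balls inside `U` (the hypothesis of `exists_properGermKernel`, which is
  thereby shown to be NECESSARY as well as sufficient for being specified by proper germ-Markov kernels).

## References

* H.-O. Georgii, *Gibbs Measures and Phase Transitions*, 2nd ed. (2011), Def. 1.23, Prop. 7.22, 7.25.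
  [Georgii2011]
* M. Röckner, Comm. Math. Phys. 106 (1986) 105–135, §1. [Rockner1986]
-/

noncomputable section

namespace Literature.MathematicalPhysics.QuantumLattice

open _root_.MeasureTheory _root_.ProbabilityTheory Set Metric
open scoped ENNReal SchwartzMap

variable {E : Type*} [NormedAddCommGroup E] [NormedSpace ℝ E]

namespace IsGibbsFor

variable {γ : E → ℝ → FieldConfig E → Measure (FieldConfig E)} {ν : Measure (FieldConfig E)} {U : Set E}

/-- **DLR kernels are versions of the conditional probability kernel** (Georgii 2011, Prop. 7.22/7.25 in
the ball-indexed setting of Röckner 1986 §1): if `ν` satisfies the DLR equations `ν (A ∩ B) = ∫_B γ c r η A dν`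
on the balls with closure inside `U` and `η ↦ γ c r η A` is `extEvents (closedBall c r)ᶜ`-measurable, then for
every ball `closedBall c r ⊆ U` (`0 < r`) and every Borel event `A`,
`γ c r · A = condExpKernel ν (extEvents (closedBall c r)ᶜ) · A` `ν`-almost everywhere. (The instance
arguments `[StandardBorelSpace (FieldConfig E)]` — for finite-dimensional `E` supply it with
`haveI := standardBorelSpace_fieldConfig` — and `[IsFiniteMeasure ν]`, implied by `IsGibbsFor`
(`haveI := h.isProbabilityMeasure`), are needed to write `condExpKernel ν`.) [cite: Georgii2011, Prop. 7.25] -/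
theorem apply_ae_eq_condExpKernel [StandardBorelSpace (FieldConfig E)] [IsFiniteMeasure ν]
    (h : IsGibbsFor γ ν U)
    (hmeas : ∀ c r, 0 < r → ∀ (A : Set (FieldConfig E)), MeasurableSet A →
      Measurable[extEvents (closedBall c r)ᶜ] fun η => γ c r η A)
    {c : E} {r : ℝ} (hr : 0 < r) (hsub : closedBall c r ⊆ U) {A : Set (FieldConfig E)}
    (hA : MeasurableSet A) :
    (fun η => γ c r η A) =ᵐ[ν] fun η => condExpKernel ν (extEvents (closedBall c r)ᶜ) η A := by
  refine ae_eq_of_setLIntegral_eq_of_measurable_sub (extEvents_le _) (hmeas c r hr A hA)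
    (measurable_condExpKernel hA) fun B hB => ?_
  rw [setLIntegral_condExpKernel_eq_inter (extEvents_le _) hA hB, Set.inter_comm]
  exact (h.2 c r hr hsub A hA B hB).symm

/-- **Necessity of the a.e. germ-Markov property**: if `ν` satisfies the DLR equations on the balls inside
`U` for kernels that are Markov across spheres (interior events `A ∈ extEvents (ball c r)` are
`germEvents c r`-measurable in the datum), then for every ball `closedBall c r ⊆ U` (`0 < r`) and every
interior event `A` there is a `germEvents c r`-measurable `g` with `ν (A ∩ B) = ∫_B g dν` for all exterior
events `B` — namely `g = γ c r · A`. Converse of `exists_properGermKernel`. [cite: Rockner1986, §1] -/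
theorem exists_germ_version (h : IsGibbsFor γ ν U)
    (hmarkov : ∀ c r, 0 < r → ∀ (A : Set (FieldConfig E)), MeasurableSet[extEvents (ball c r)] A →
      Measurable[germEvents c r] fun η => γ c r η A)
    {c : E} {r : ℝ} (hr : 0 < r) (hsub : closedBall c r ⊆ U) {A : Set (FieldConfig E)}
    (hA : MeasurableSet[extEvents (ball c r)] A) :
    ∃ g : FieldConfig E → ℝ≥0∞, Measurable[germEvents c r] g ∧
      ∀ B : Set (FieldConfig E), MeasurableSet[extEvents (closedBall c r)ᶜ] B →
        ν (A ∩ B) = ∫⁻ η in B, g η ∂ν :=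
  ⟨fun η => γ c r η A, hmarkov c r hr A hA, fun B hB => h.2 c r hr hsub A (extEvents_le _ A hA) B hB⟩

end IsGibbsFor

/-- **Characterisation** (for `E` finite-dimensional and a fixed ball, `0 < r`): a probability law `μ` on
`𝓢'(E)` admits a kernel of probability measures that is exterior-measurable on Borel events, EXACTLY
germ-measurable on interior events, proper for every datum and DLR for `μ` on the ball `closedBall c r`
IF AND ONLY IF every interior event has a germ-measurable version of its conditional probability given the
exterior events (`exists_properGermKernel` and its converse). [cite: Rockner1986, §1] -/
theorem exists_properGermKernel_iff [FiniteDimensional ℝ E] (μ : Measure (FieldConfig E))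
    [IsProbabilityMeasure μ] (c : E) (r : ℝ) :
    (∃ Γ : FieldConfig E → Measure (FieldConfig E),
      (∀ η, IsProbabilityMeasure (Γ η)) ∧
      (∀ A, MeasurableSet A → Measurable[extEvents (closedBall c r)ᶜ] fun η => Γ η A) ∧
      (∀ A, MeasurableSet[extEvents (ball c r)] A →
        Measurable[germEvents c r] fun η => Γ η A) ∧
      (∀ η, ∀ᵐ ω ∂Γ η, ∀ f : 𝓢(E, ℝ), tsupport f ⊆ (closedBall c r)ᶜ → ω f = η f) ∧
      ∀ A, MeasurableSet A → ∀ B, MeasurableSet[extEvents (closedBall c r)ᶜ] B →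
        μ (A ∩ B) = ∫⁻ η in B, Γ η A ∂μ) ↔
    (∀ A : Set (FieldConfig E), MeasurableSet[extEvents (ball c r)] A →
      ∃ g : FieldConfig E → ℝ≥0∞, Measurable[germEvents c r] g ∧
        ∀ B : Set (FieldConfig E), MeasurableSet[extEvents (closedBall c r)ᶜ] B →
          μ (A ∩ B) = ∫⁻ η in B, g η ∂μ) := by
  refine ⟨fun ⟨Γ, _, _, hΓm, _, hΓd⟩ A hA => ⟨fun η => Γ η A, hΓm A hA,
    fun B hB => hΓd A (extEvents_le _ A hA) B hB⟩, fun hM => exists_properGermKernel μ c r hM⟩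

end Literature.MathematicalPhysics.QuantumLattice

end
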